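import Mathlib.Algebra.Order.Archimedean.Basic
import Literature.AlgebraicGeometry.Frobenioids.PerfFactorial
import Literature.AlgebraicGeometry.Frobenioids.Factorization
import Literature.AnabelianGeometry.EtaleTheta.RealificationCoordinates
import Literature.AnabelianGeometry.EtaleTheta.PerfectionPrimes

/-!
# Monoprime monoids are divisorial and perf-factorial (toolkit for [EtTh] Remark 3.5.1)

Source of the notions: S. Mochizuki, *The geometry of Frobenioids I* [MochizukiFrdI2008], §0 p. 10
(`Λ`-monoprime monoids), p. 12 (primary elements, primes, `M_𝔭`), Def. 1.1 (i) p. 19 (divisorial),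
Def. 2.4 (i) pp. 47–48 (perf-factorial). Used for S. Mochizuki, *The étale theta function …*
[MochizukiEtTh2009], Remark 3.5.1, PDF p. 76 (printed 302): "a nonzero submonoid `P` of an
`ℝ`-monoprime monoid `Q` is perf-factorial and group-saturated if and only if it is monoprime" — whose
"if" direction needs that a monoprime monoid IS perf-factorial, a fact [FrdI] uses tacitly (e.g. for
`ℤ_{≥0} ≅ ord(O_K^▷)` in [FrdII] Ex. 1.1) and which is proved here, stub-free over the tree
(`Frobenioids/Monoids.lean`, `PerfFactorial.lean`):

* `dvd_of_hom_le`: an injective homomorphism from a monoprime monoid into `ℝ_{≥0}` reflects `≤`;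
* archimedean monoids (`∀ a b, b ≠ 1 → a ≼ b`): every non-unit is primary, there is exactly one prime
  `𝔭` (given a non-unit) and `M_𝔭 = M` (`submonoid_eq_top`);
* a monoprime monoid is archimedean, sharp, cancellative, saturated, hence DIVISORIAL (`isDivisorial`);
* its factorization map is `a ↦ (a) ∈ M^pf = M^pf_𝔮` (`factorMap_apply`), so conditions (c), (d) of
  Def. 2.4 (i) hold and a monoprime monoid is PERF-FACTORIAL (`isPerfFactorial`).

Proof-only (no definitions). Seat abc-iut-L2-d2 (cell abc-iut, node EtTh:Rmk3.5.1).
-/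

namespace Literature.AnabelianGeometry.EtaleTheta

namespace MonoprimeStructure

open Literature.AlgebraicGeometry.Frobenioids NNReal Function RealificationCoord

universe u

variable {N : Type u} [CommMonoid N]

/-! ### Injective homomorphisms from a monoprime monoid into `ℝ_{≥0}` -/

/-- Transport of an injective `g : N → ℝ_{≥0}` along a chart `e : N ≅ Λ_{≥0}`: an additive
`φ : Λ_{≥0} → ℝ_{≥0}` with `g = φ ∘ e` and `φ 1 ≠ 0`. [cite: MochizukiFrdI2008, §0 p.10] -/
private theorem exists_chartHom (g : N →* Multiplicative ℝ≥0) (hg : Injective g) {A : Type}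
    [AddCommMonoid A] [One A] (h10 : (1 : A) ≠ 0) (e : N ≃* Multiplicative A) :
    ∃ φ : A →+ ℝ≥0, φ 1 ≠ 0 ∧ ∀ x : N, Multiplicative.toAdd (g x) = φ (Multiplicative.toAdd (e x)) := by
  let φ : A →+ ℝ≥0 := AddMonoidHom.toMultiplicative.symm (g.comp e.symm.toMonoidHom)
  have hφ : ∀ a : A, φ a = Multiplicative.toAdd (g (e.symm (Multiplicative.ofAdd a))) := fun _ => rfl
  refine ⟨φ, fun h => h10 ?_, fun x => ?_⟩
  · have h1 : φ 1 = φ 0 := by rw [h, map_zero]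
    rw [hφ, hφ] at h1
    exact Multiplicative.ofAdd.injective (e.symm.injective (hg (Multiplicative.toAdd.injective h1)))
  · rw [hφ, ofAdd_toAdd, MulEquiv.symm_apply_apply]

/-- **Order reflection for embeddings of monoprime monoids in `ℝ_{≥0}`**: if `N` is monoprime and
`g : N ↪ ℝ_{≥0}` is an injective homomorphism, then `g x ≤ g y` implies `x ∣ y` (in a chart `g` is a
homothety `x ↦ c · x` of `Λ_{≥0} ⊆ ℝ_{≥0}`). [cite: MochizukiFrdI2008, §0 p.10] -/
theorem dvd_of_hom_le (hN : IsMonoprime N) (g : N →* Multiplicative ℝ≥0) (hg : Injective g) {x y : N}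
    (h : Multiplicative.toAdd (g x) ≤ Multiplicative.toAdd (g y)) : x ∣ y := by
  rcases hN with ⟨⟨⟨e⟩⟩⟩ | ⟨⟨⟨e⟩⟩⟩ | ⟨⟨⟨e⟩⟩⟩
  · obtain ⟨φ, hφ, hgφ⟩ := exists_chartHom g hg one_ne_zero e
    rw [hgφ, hgφ] at h
    have hlin : ∀ n : ℕ, φ n = (n : ℝ≥0) * φ 1 := fun n => by
      rw [← nsmul_eq_mul, ← map_nsmul, smul_eq_mul, mul_one]
    rw [hlin (Multiplicative.toAdd (e x)), hlin (Multiplicative.toAdd (e y))] at h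
    have h' : Multiplicative.toAdd (e x) ≤ Multiplicative.toAdd (e y) := by
      have := le_of_mul_le_mul_right h (pos_iff_ne_zero.mpr hφ)
      exact_mod_cast this
    obtain ⟨d, hd⟩ := Nat.exists_eq_add_of_le h'
    refine ⟨e.symm (Multiplicative.ofAdd d), e.injective ?_⟩
    rw [map_mul, MulEquiv.apply_symm_apply, ← ofAdd_toAdd (e x), ← ofAdd_add, ← hd, ofAdd_toAdd]
  · obtain ⟨φ, hφ, hgφ⟩ := exists_chartHom g hg one_ne_zero e
    rw [hgφ, hgφ, addMonoidHom_nnrat_apply φ, addMonoidHom_nnrat_apply φ (Multiplicative.toAdd (e y))] at h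
    have h' : Multiplicative.toAdd (e x) ≤ Multiplicative.toAdd (e y) := by
      exact_mod_cast le_of_mul_le_mul_left h (pos_iff_ne_zero.mpr hφ)
    obtain ⟨d, hd⟩ := exists_add_of_le h'
    refine ⟨e.symm (Multiplicative.ofAdd d), e.injective ?_⟩
    rw [map_mul, MulEquiv.apply_symm_apply, ← ofAdd_toAdd (e x), ← ofAdd_add, ← hd, ofAdd_toAdd]
  · obtain ⟨φ, hφ, hgφ⟩ := exists_chartHom g hg one_ne_zero e
    rw [hgφ, hgφ, addMonoidHom_nnreal_apply φ, addMonoidHom_nnreal_apply φ (Multiplicative.toAdd (e y))] at h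
    have h' : Multiplicative.toAdd (e x) ≤ Multiplicative.toAdd (e y) :=
      le_of_mul_le_mul_left h (pos_iff_ne_zero.mpr hφ)
    obtain ⟨d, hd⟩ := exists_add_of_le h'
    refine ⟨e.symm (Multiplicative.ofAdd d), e.injective ?_⟩
    rw [map_mul, MulEquiv.apply_symm_apply, ← ofAdd_toAdd (e x), ← ofAdd_add, ← hd, ofAdd_toAdd]

/-- An injective homomorphism `g : N ↪ ℝ_{≥0}` from a monoprime monoid makes `N` archimedean for
`≼`: `a ≼ b` whenever `b ≠ 1` (`g a ≤ n · g b` for large `n`). [cite: MochizukiFrdI2008, §0 p.12] -/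
theorem precsim_of_hom (hN : IsMonoprime N) (g : N →* Multiplicative ℝ≥0) (hg : Injective g)
    {a b : N} (hb : b ≠ 1) : a ≼ b := by
  have hgb : Multiplicative.toAdd (g b) ≠ 0 := by
    intro h0
    apply hb
    apply hg
    apply Multiplicative.toAdd.injective
    rw [h0, map_one, toAdd_one]
  obtain ⟨n, hn⟩ := exists_nat_ge (Multiplicative.toAdd (g a) / Multiplicative.toAdd (g b))
  refine ⟨n + 1, Nat.succ_pos n, dvd_of_hom_le hN g hg ?_⟩
  rw [map_pow, toAdd_pow, nsmul_eq_mul]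
  have : Multiplicative.toAdd (g a) ≤ (n : ℝ≥0) * Multiplicative.toAdd (g b) := by
    rwa [div_le_iff₀ (pos_iff_ne_zero.mpr hgb)] at hn
  refine this.trans ?_
  gcongr
  exact_mod_cast Nat.le_succ n

/-! ### Archimedean monoids: one prime -/

/-- If every `a` satisfies `a ≼ b` for all non-units `b`, then the primary elements are exactly the
non-units ([FrdI] §0 p. 12). [cite: MochizukiFrdI2008, §0 p.12] -/
theorem isPrimary_iff_ne_one (harch : ∀ a b : N, b ≠ 1 → a ≼ b) {a : N} : IsPrimary a ↔ a ≠ 1 :=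
  ⟨fun h => h.1, fun ha => ⟨ha, fun b hb _ => harch a b hb⟩⟩

/-- In an archimedean monoid any two primes coincide. [cite: MochizukiFrdI2008, §0 p.12] -/
theorem primes_subsingleton (harch : ∀ a b : N, b ≠ 1 → a ≼ b) : Subsingleton (Primes N) := by
  refine ⟨fun p q => ?_⟩
  obtain ⟨⟨a, ha⟩, rfl⟩ := Quotient.mk_surjective p
  obtain ⟨⟨b, hb⟩, rfl⟩ := Quotient.mk_surjective q
  exact Quotient.sound (harch a b hb.1)

/-- In an archimedean monoid a non-unit determines a prime. [cite: MochizukiFrdI2008, §0 p.12] -/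
theorem primes_nonempty (harch : ∀ a b : N, b ≠ 1 → a ≼ b) {ε : N} (hε : ε ≠ 1) : Nonempty (Primes N) :=
  ⟨Quotient.mk (primarySetoid N) ⟨ε, (isPrimary_iff_ne_one harch).mpr hε⟩⟩

/-- In an archimedean monoid every non-unit lies in (the subset of) every prime.
[cite: MochizukiFrdI2008, §0 p.12] -/
theorem mem_carrier_of_ne_one (harch : ∀ a b : N, b ≠ 1 → a ≼ b) (𝔭 : Primes N) {a : N} (ha : a ≠ 1) :
    a ∈ 𝔭.carrier := by
  exact ⟨(isPrimary_iff_ne_one harch).mpr ha, (primes_subsingleton harch).elim _ _⟩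

/-- In an archimedean monoid `N_𝔭 = N` for every prime `𝔭`. [cite: MochizukiFrdI2008, §0 p.12] -/
theorem submonoid_eq_top (harch : ∀ a b : N, b ≠ 1 → a ≼ b) (𝔭 : Primes N) : 𝔭.submonoid = ⊤ := by
  refine eq_top_iff.mpr fun a _ => ?_
  by_cases ha : a = 1
  · rw [ha]; exact Submonoid.one_mem _
  · exact Submonoid.subset_closure (mem_carrier_of_ne_one harch 𝔭 ha)

/-- In an archimedean monoid `N_𝔭 ≅ N`. [cite: MochizukiFrdI2008, §0 p.12] -/
theorem nonempty_submonoid_mulEquiv (harch : ∀ a b : N, b ≠ 1 → a ≼ b) (𝔭 : Primes N) :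
    Nonempty (↥𝔭.submonoid ≃* N) :=
  ⟨(MulEquiv.submonoidCongr (submonoid_eq_top harch 𝔭)).trans Submonoid.topEquiv⟩

/-! ### Monoprime monoids are archimedean and divisorial -/

/-- A monoprime monoid has a non-unit. [cite: MochizukiFrdI2008, §0 p.10] -/
theorem exists_ne_one (hN : IsMonoprime N) : ∃ ε : N, ε ≠ 1 := by
  obtain ⟨f⟩ := nonempty_coord hN
  obtain ⟨b, hb⟩ := exists_coord_ge f hN 1
  refine ⟨b, fun h => ?_⟩
  rw [h, coord_one f] at hb
  exact not_lt.mpr hb zero_lt_one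

/-- The coordinate `N → N ⊗ ℝ_{≥0} ≅ ℝ_{≥0}` as an injective homomorphism. [cite: MochizukiFrdI2008, §0 p.10] -/
private theorem coordHom_injective (hN : IsMonoprime N) (f : Realification N ≃* Multiplicative ℝ≥0) :
    Injective (f.toMonoidHom.comp (Realification.of N)) :=
  f.injective.comp (Realification.of_injective hN)

/-- **A monoprime monoid is archimedean**: `a ≼ b` for every non-unit `b`. [cite: MochizukiFrdI2008, §0 p.12] -/
theorem precsim_of_ne_one (hN : IsMonoprime N) {a b : N} (hb : b ≠ 1) : a ≼ b := by
  obtain ⟨f⟩ := nonempty_coord hN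
  exact precsim_of_hom hN _ (coordHom_injective hN f) hb

/-- For monoprime `N`: every `N_𝔭` is monoprime ([FrdI] Def. 2.4 (i)(b) for `N`).
[cite: MochizukiFrdI2008, Def. 2.4(i) p.47] -/
theorem isMonoprime_submonoid (hN : IsMonoprime N) (𝔭 : Primes N) : IsMonoprime ↥𝔭.submonoid := by
  obtain ⟨e⟩ := nonempty_submonoid_mulEquiv (fun _ _ hb => precsim_of_ne_one hN hb) 𝔭
  exact PerfectionPrimes.isMonoprime_of_mulEquiv e.symm hN

/-- A monoprime monoid is sharp. [cite: MochizukiFrdI2008, §0 p.11] -/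
theorem isSharp (hN : IsMonoprime N) : IsSharp N := by
  obtain ⟨f⟩ := nonempty_coord hN
  refine ⟨fun u hu => ?_⟩
  obtain ⟨v, hv⟩ := hu.exists_right_inv
  have h : Multiplicative.toAdd (f (Realification.of N u)) + Multiplicative.toAdd (f (Realification.of N v)) = 0 := by
    rw [← coord_mul f, hv, coord_one f]
  exact coord_injective f hN ((add_eq_zero.mp h).1.trans (coord_one f).symm)

/-- A monoprime monoid is cancellative. [cite: MochizukiFrdI2008, §0 p.11] -/
theorem isCancelMul (hN : IsMonoprime N) : IsCancelMul N := by
  obtain ⟨f⟩ := nonempty_coord hN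
  have key : ∀ a b c : N, a * b = a * c → b = c := fun a b c h => by
    apply coord_injective f hN
    have := congrArg (fun x => Multiplicative.toAdd (f (Realification.of N x))) h
    simp only [coord_mul f] at this
    exact add_left_cancel this
  exact
    { mul_left_cancel := key
      mul_right_cancel := fun a b c h => key a b c (by rw [mul_comm a b, mul_comm a c]; exact h) }

/-- A monoprime monoid is integral. [cite: MochizukiFrdI2008, §0 p.11] -/
theorem isIntegral (hN : IsMonoprime N) : IsIntegral N :=
  isIntegral_iff_isCancelMul.mpr (isCancelMul hN)

/-- A monoprime monoid is saturated (`n · x ≥ 0 ⇒ x ≥ 0` in `Λ`). [cite: MochizukiFrdI2008, §0 p.11] -/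
theorem isSaturated (hN : IsMonoprime N) : IsSaturated N := by
  haveI := isCancelMul hN
  obtain ⟨f⟩ := nonempty_coord hN
  refine ⟨fun x n hn ⟨c, hc⟩ => ?_⟩
  obtain ⟨⟨a, b⟩, h⟩ := (Localization.monoidOf (⊤ : Submonoid N)).surj x
  have hb : x = Algebra.GrothendieckGroup.of a / Algebra.GrothendieckGroup.of (b : N) :=
    eq_div_iff_mul_eq'.mpr h
  have hab : a ^ n = c * (b : N) ^ n := by
    apply Algebra.GrothendieckGroup.of_injective
    rw [map_mul, map_pow, map_pow, hc, hb, div_pow, div_mul_cancel]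
  have hle : Multiplicative.toAdd (f (Realification.of N (b : N))) ≤
      Multiplicative.toAdd (f (Realification.of N a)) := by
    have h' : (n : ℝ≥0) * Multiplicative.toAdd (f (Realification.of N a)) =
        Multiplicative.toAdd (f (Realification.of N c)) + n * Multiplicative.toAdd (f (Realification.of N (b : N))) := by
      rw [← coord_pow f, hab, coord_mul f, coord_pow f]
    have hn' : (0 : ℝ≥0) < n := by exact_mod_cast hn
    have h'' : (n : ℝ≥0) * Multiplicative.toAdd (f (Realification.of N (b : N))) ≤
        n * Multiplicative.toAdd (f (Realification.of N a)) := by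
      rw [h']; exact le_add_self
    exact le_of_mul_le_mul_left h'' hn'
  obtain ⟨d, hd⟩ := dvd_of_coord_le f hN hle
  refine ⟨d, ?_⟩
  rw [hb, eq_div_iff_mul_eq', ← map_mul, hd, mul_comm]

/-- A monoprime monoid is of characteristic type. [cite: MochizukiFrdI2008, §0 p.11] -/
theorem isOfCharType (hN : IsMonoprime N) : IsOfCharType N :=
  ⟨fun u _ _ => Units.ext ((isSharp hN).1 (u : N) u.isUnit)⟩

/-- **A monoprime monoid is divisorial** ([FrdI] Def. 1.1 (i)). [cite: MochizukiFrdI2008, Def. 1.1(i)] -/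
theorem isDivisorial (hN : IsMonoprime N) : IsDivisorial N where
  isPreDivisorial :=
    { isIntegral := isIntegral hN
      isSaturated := isSaturated hN
      isOfCharType := isOfCharType hN }
  isSharp := isSharp hN

/-! ### Monoprime monoids are perf-factorial -/

section PerfFactorial

variable {M : Type u} [CommMonoid M]

/-- The `≼`-archimedean property of `M^pf` for monoprime `M`. [cite: MochizukiFrdI2008, §0 p.12] -/
private theorem harch_perfection (hM : IsMonoprime M) :
    ∀ a b : Perfection M, b ≠ 1 → a ≼ b :=
  fun _ _ hb => precsim_of_ne_one (PerfectionPrimes.isMonoprime_perfection hM) hb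

/-- **The factorization map of a monoprime monoid is `a ↦ (a)`**: for monoprime `M`, `M^pf` has a
single prime `𝔮` with `M^pf_𝔮 = M^pf`, `Bound_{𝔮 ∪ {0}}(a)` is the set of all `x ≤ a`, and its
supremum in `M^pf_𝔮 ⊗ ℝ_{≥0}` is (the image of) `a` itself. [cite: MochizukiFrdI2008, Def. 2.4(i) p.47] -/
theorem factorMap_apply (hM : IsMonoprime M) {a : Perfection M} {𝔮 : Primes (Perfection M)}
    (x : PfAt M 𝔮) (hx : (x : Perfection M) = a) :
    factorMap M a 𝔮 = Realification.of (PfAt M 𝔮) x := by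
  have harch := harch_perfection hM
  have htop := submonoid_eq_top harch 𝔮
  -- `of x` is a supremum of `Bound_{𝔮 ∪ {0}}(a)`
  have H : ∀ b : RlfAt M 𝔮, IsBoundedBy (boundAt M 𝔮 a) b ↔ Realification.of (PfAt M 𝔮) x ∣ b := by
    intro b
    constructor
    · intro hb
      apply hb
      refine ⟨x, ?_, hx ▸ dvd_rfl, rfl⟩
      by_cases h1 : (x : Perfection M) = 1
      · exact Or.inr h1
      · exact Or.inl (mem_carrier_of_ne_one harch 𝔮 h1)
    · rintro hb _ ⟨y, -, hya, rfl⟩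
      refine (Realification.of_dvd ?_).trans hb
      obtain ⟨c, hc⟩ := hya
      have hcmem : c ∈ 𝔮.submonoid := by rw [htop]; exact Submonoid.mem_top c
      exact ⟨⟨c, hcmem⟩, Subtype.ext (by rw [Submonoid.coe_mul, hx, hc])⟩
  have hspec := divSup_spec ⟨_, H⟩
  apply Realification.dvd_antisymm
  · exact (hspec _).mp ((H _).mpr dvd_rfl)
  · exact (H _).mp ((hspec _).mpr dvd_rfl)

/-- Membership in `M^pf_𝔮 = M^pf` (monoprime `M`). [cite: MochizukiFrdI2008, Def. 2.4(i) p.47] -/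
private theorem mem_pfAt (hM : IsMonoprime M) (𝔮 : Primes (Perfection M)) (a : Perfection M) :
    a ∈ 𝔮.submonoid := by
  rw [submonoid_eq_top (harch_perfection hM) 𝔮]
  exact Submonoid.mem_top a

/-- **A monoprime monoid is perf-factorial** ([FrdI] Def. 2.4 (i)): divisorial, `M_𝔭 = M` monoprime,
and the factorization map `M^pf → M^pf_𝔮 ⊗ ℝ_{≥0}` is the (injective, homomorphic) natural map with
(c), (d) immediate. [cite: MochizukiFrdI2008, Def. 2.4(i) p.47] -/
theorem isPerfFactorial (hM : IsMonoprime M) : IsPerfFactorial M := by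
  have hMpf : IsMonoprime (Perfection M) := PerfectionPrimes.isMonoprime_perfection hM
  have harch := harch_perfection hM
  have hsub := primes_subsingleton harch
  obtain ⟨ε, hε⟩ := exists_ne_one hMpf
  obtain ⟨𝔮₀⟩ := primes_nonempty harch hε
  have hfm : ∀ (a : Perfection M) (𝔮 : Primes (Perfection M)),
      factorMap M a 𝔮 = Realification.of (PfAt M 𝔮) ⟨a, mem_pfAt hM 𝔮 a⟩ :=
    fun a 𝔮 => factorMap_apply hM _ rfl
  exact
    { isDivisorial := isDivisorial hM
      isMonoprime := isMonoprime_submonoid hM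
      bounded := fun 𝔮 a => ⟨Realification.of (PfAt M 𝔮) ⟨a, mem_pfAt hM 𝔮 a⟩, by
        rintro _ ⟨y, -, hya, rfl⟩
        apply Realification.of_dvd
        obtain ⟨c, hc⟩ := hya
        exact ⟨⟨c, mem_pfAt hM 𝔮 c⟩, Subtype.ext (by rw [Submonoid.coe_mul, hc])⟩⟩
      factorMap_one := funext fun 𝔮 => by rw [hfm]; exact map_one (Realification.of (PfAt M 𝔮))
      factorMap_mul := fun a b => funext fun 𝔮 => by
        rw [Pi.mul_apply, hfm, hfm, hfm, ← map_mul]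
        rfl
      factorMap_injective := fun a b hab => by
        have h := congrFun hab 𝔮₀
        rw [hfm, hfm] at h
        exact congrArg Subtype.val (Realification.of_injective (isMonoprime_submonoid hMpf 𝔮₀) h)
      factorMap_mem_range := fun a => ⟨fun 𝔮 => ⟨a, mem_pfAt hM 𝔮 a⟩, funext fun 𝔮 => by
        rw [pfFactorToRlfFactor_apply, hfm]⟩
      mem_range_of_supp_subset := fun x b _ => ⟨(x 𝔮₀ : Perfection M), funext fun 𝔮 => by
        obtain rfl : 𝔮₀ = 𝔮 := hsub.elim _ _
        rw [pfFactorToRlfFactor_apply, hfm]⟩ }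

end PerfFactorial

end MonoprimeStructure

end Literature.AnabelianGeometry.EtaleTheta
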